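import Literature.AlgebraicGeometry.Deligne1982.WeilTypeCMDiscriminantExists
import Literature.AlgebraicGeometry.Motives.HyperbolicWeilType
import HarnessLib

/-!
# Hyperbolic Weil type from a totally isotropic `E`-subspace of the Hermitian form of a polarized abelian variety of Weil type relative to a CM field (Deligne 1982, §4 Cor. 4.2 (b), transport to the carriers)

Layer `Literature/AlgebraicGeometry/Deligne1982`; theorems only (no definition, no named fact).
Companion of `Deligne1982/WeilTypeCMDiscriminant` (`HasWeilDiscriminantCM A η R e₀ k h δ`: an `E`-basis
`x_b` of `H¹(A, ℚ)`, the rational form `ψ = Q_h/ω`, the Gram matrix `Φ ∈ M_{2k}(E)` of Deligne's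
sesquilinear form `φ₁ = f φ` of Lemma 4.6, `E = ℚ(η) ≅ ℚ[T]/(R(T²))`) and of
`Deligne1982/WeilTypeCMDiscriminantExists` (Lemma 4.6 / Sublemma 4.7 proved on the carriers), and the
CM-field twin of `Motives/HyperbolicWeilTypeOfRationalModel` (the transport step for `E` imaginary
quadratic). It PROVES the step "(b) there is a totally isotropic subspace of `V` of dimension `d/2`"
⟹ "`H¹(A, ℚ)` contains an `E`-stable `ℚ`-subspace of dimension `2 · (d/2) · [E:ℚ]/2 = dim A`,
Lagrangian for the Riemann form" — i.e. `Motives.IsHyperbolicWeilType A η (k·e₀) h` — for a CM field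
`E` of ANY degree `2e₀`:

* `form_sum_smul_eq_trace` — for a `K₀`-bilinear form `ψ` on an `E`-vector space `V` with
  `ψ(ev, w) = ψ(v, σ(e)w)` (`σ` an involution of `E`) and Deligne's `φ₁ = hermitianCoeff ψ`
  (`Tr_{E/K₀}(φ₁(v, w)e) = ψ(ev, w)`, Sublemma 4.7): for vectors `β_a` and coefficients `α, γ ∈ E^ι`,
  `ψ(Σ α_a β_a, Σ γ_b β_b) = Tr_{E/K₀}(Σ_{a,b} α_a φ₁(β_a, β_b) σ(γ_b))` ("`ψ(x, y) = Tr_{E/ℚ}(f φ(x, y))`"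
  read in coordinates);
* **`isHyperbolicWeilType_of_isotropic_cmSubspace`** — ON THE CARRIERS: for a Weil-type CM datum
  `IsWeilTypeCM A η R e₀ k`, a rational class `h` whose Rosati involution induces complex conjugation on
  `E` (`Q_h(η^*x, y) = -Q_h(x, η^*y)`), discriminant-witness data `(x, ω, c, Φ)` as in
  `HasWeilDiscriminantCM` (`Q_h((η^*)ʲx_a, x_b) = c_{abj} ω`, `Tr_{E/ℚ}(tʲΦ_{ab}) = c_{abj}`), and an
  `E`-subspace `W ≤ E^{2k}` of dimension `k` which is totally isotropic for
  `(α, γ) ↦ Σ_{a,b} α_a Φ_{ab} \overline{γ_b}`: `(A, η)` is of hyperbolic Weil type in half-dimension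
  `k · e₀` for `h`. Proof: `H¹(A, ℚ)` is an `E`-vector space through `t ↦ η^*_ℚ`
  (`exists_module_cmField_smul_eq`); the `x_b = β_b ⊗ 1` form an `E`-basis `β` (the `tʲβ_b` are a
  `ℚ`-basis by the witness's independence clause and `d[E:ℚ] = 2 dim A`); by the trace duality
  (`hermitianCoeff_eq_of_trace`) the witness's `Φ_{ab}` IS `φ₁(β_a, β_b)` for the rational form
  `ψ = Q_h/ω` (`ratPolarizationForm`); the image `W' = {Σ α_a β_a | α ∈ W}` is an `E`-stable
  `ℚ`-subspace of `H¹(A, ℚ)` of dimension `2e₀ · k` on which `ψ = Tr_{E/ℚ}(0) = 0`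
  (`form_sum_smul_eq_trace`), and a `ℚ`-basis of `W'`, tensored with `ℂ`, is the hyperbolic frame
  (rational, `ℂ`-independent by `linearIndependent_ringChange_iff`, `η^*`-stable, `Q_h`-isotropic).

This is the transport half of Deligne's Cor. 4.2 (a) ⟹ (b) ⟹ "split" on the tree's carriers; the
arithmetic half (Landherr: signatures `a_τ = b_τ` and `disc φ = (-1)^{d/2}` give the isotropic `W`) is
the tree's `QuadraticForms.hermitianMatrices_congruent_iff_invariants`, applied in the companion file
`Deligne1982/HyperbolicOfSplitDiscriminantCM`. Relies on nothing unproved.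

## References

* [Deligne1982HodgeCycles] P. Deligne (notes by J. S. Milne), Hodge cycles on abelian varieties,
  LNM 900 (1982), §4: p. 30 (Hermitian forms, discriminant), Prop. 4.1, Cor. 4.2, Lemma 4.6,
  Sublemma 4.7 (pp. 30–34 of the 2003 TeXed re-edition).
* [vanGeemen1994HodgeAV] B. van Geemen, LNM 1594 (1994), Lemma 5.2 (2)–(3), 5.4 (5.4.1) (the quadratic case).
* [Landherr1936HermitianForms] W. Landherr, Abh. Math. Sem. Hamburg 11 (1936) 245–248.
* [HatcherAT2002] A. Hatcher, Algebraic Topology (2002), §3.1 p. 198.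
-/

noncomputable section

open CategoryTheory Polynomial Module
open Literature.AlgebraicTopology.SingularHomology
open Literature.AlgebraicGeometry.HodgeTheory
open Literature.AlgebraicGeometry.Motives (AbelianVariety polarizationPairingOne bettiCohomology ComplexPoints
  IsSmoothProjective IsHyperbolicWeilType)
open Literature.AlgebraicGeometry.VanGeemen1994 (pullbackOne)

namespace Literature.AlgebraicGeometry.Deligne1982

/-! ### §1 `ψ(Σ α_a β_a, Σ γ_b β_b) = Tr_{E/K₀}(Σ α_a φ₁(β_a, β_b) σ(γ_b))` -/

section GramForm

variable {K₀ : Type*} [Field K₀] {E : Type*} [Field E] [Algebra K₀ E] [FiniteDimensional K₀ E]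
  [Algebra.IsSeparable K₀ E]
  {V : Type*} [AddCommGroup V] [Module K₀ V] [Module E V] [IsScalarTower K₀ E V]
  (ψ : V →ₗ[K₀] V →ₗ[K₀] K₀)

/-- **`ψ = Tr_{E/K₀}(φ₁)` in coordinates**: for a `K₀`-bilinear form `ψ` with `ψ(ev, w) = ψ(v, σ(e)w)`
(`σ` an involution of `E`: "the Rosati involution … induces complex conjugation on `E`") and Deligne's
`E`-valued `φ₁ = hermitianCoeff ψ` (`Tr(φ₁(v, w)e) = ψ(ev, w)`, Sublemma 4.7), one has, for any vectors
`β_a` and coefficient vectors `α, γ ∈ E^ι`,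
`ψ(Σ_a α_a β_a, Σ_b γ_b β_b) = Tr_{E/K₀}(Σ_a Σ_b α_a φ₁(β_a, β_b) σ(γ_b))`.
[cite: Deligne1982HodgeCycles, §4 Lemma 4.6 and Sublemma 4.7 (p. 34)] -/
theorem form_sum_smul_eq_trace (σ : E → E) (hσσ : ∀ e, σ (σ e) = e)
    (hψσ : ∀ (e : E) (v w : V), ψ (e • v) w = ψ v (σ e • w))
    {ι : Type*} [Fintype ι] (β : ι → V) (α γ : ι → E) :
    ψ (∑ a, α a • β a) (∑ b, γ b • β b) =
      Algebra.trace K₀ E (∑ a, ∑ b, α a * hermitianCoeff E ψ (β a) (β b) * σ (γ b)) := by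
  have key : ∀ a b, ψ (α a • β a) (γ b • β b) =
      Algebra.trace K₀ E (α a * hermitianCoeff E ψ (β a) (β b) * σ (γ b)) := by
    intro a b
    calc ψ (α a • β a) (γ b • β b) = ψ (α a • β a) (σ (σ (γ b)) • β b) := by rw [hσσ]
      _ = ψ (σ (γ b) • (α a • β a)) (β b) := (hψσ _ _ _).symm
      _ = ψ ((σ (γ b) * α a) • β a) (β b) := by rw [mul_smul]
      _ = Algebra.trace K₀ E (hermitianCoeff E ψ (β a) (β b) * (σ (γ b) * α a)) :=
          (trace_hermitianCoeff_mul ψ (β a) (β b) _).symm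
      _ = Algebra.trace K₀ E (α a * hermitianCoeff E ψ (β a) (β b) * σ (γ b)) := by
          congr 1; ring
  simp only [map_sum, LinearMap.sum_apply, key]
  exact Finset.sum_comm

/-- **A totally isotropic coefficient space kills `ψ`**: if `Σ_{a,b} α_a φ₁(β_a, β_b) σ(γ_b) = 0` then
`ψ(Σ α_a β_a, Σ γ_b β_b) = 0` ("(b) there is a totally isotropic subspace" read through `ψ = Tr ∘ φ₁`).
[cite: Deligne1982HodgeCycles, §4 Cor. 4.2 (b) and Lemma 4.6] -/
theorem form_sum_smul_eq_zero_of_isotropic (σ : E → E) (hσσ : ∀ e, σ (σ e) = e)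
    (hψσ : ∀ (e : E) (v w : V), ψ (e • v) w = ψ v (σ e • w))
    {ι : Type*} [Fintype ι] (β : ι → V) {α γ : ι → E}
    (h0 : ∑ a, ∑ b, α a * hermitianCoeff E ψ (β a) (β b) * σ (γ b) = 0) :
    ψ (∑ a, α a • β a) (∑ b, γ b • β b) = 0 := by
  rw [form_sum_smul_eq_trace ψ σ hσσ hψσ β α γ, h0, map_zero]

end GramForm

/-! ### §2 The transport to the carriers -/

section Carriers

variable {A : AbelianVariety ℂ} {η : A ⟶ A} {R : Polynomial ℤ} {e₀ k : ℕ}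

/-- **Hyperbolic Weil type from a totally isotropic `E`-subspace** (Deligne 1982, §4 Cor. 4.2 (b) ⟹
"`V` contains … totally isotropic", transported to `H¹(A(ℂ); ℂ)`; the CM-field twin of
`Motives.isHyperbolicWeilType_of_rationalModel`). Data: a Weil-type CM datum `IsWeilTypeCM A η R e₀ k`
(`E = ℚ(η) ≅ ℚ[T]/(R(T²))` of degree `2e₀`, `dim_E H¹(A, ℚ) = 2k`), a rational class `h` whose Rosati
involution is complex conjugation on `E` (`Q_h(η^*x, y) = -Q_h(x, η^*y)`), and discriminant-witness data
as in `HasWeilDiscriminantCM`: rational classes `x_b` (`b < 2k`) whose translates `(η^*)ʲx_b` (`j < 2e₀`)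
are `ℂ`-independent, a non-zero rational top class `ω`, rationals `c_{abj}` with
`Q_h((η^*)ʲ x_a, x_b) = c_{abj} ω`, and `Φ ∈ M_{2k}(E)` with `Tr_{E/ℚ}(tʲ Φ_{ab}) = c_{abj}`. If
`W ≤ E^{2k}` is an `E`-subspace of dimension `k` on which `Σ_{a,b} α_a Φ_{ab} \overline{γ_b} = 0`
(totally isotropic for the sesquilinear form with Gram matrix `Φ`), then `(A, η)` is of HYPERBOLIC Weil
type in half-dimension `k · e₀` for `h`: `H¹(A(ℂ); ℂ)` contains a rational, `ℂ`-independent, `η^*`-stable,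
`Q_h`-isotropic `2ke₀ = dim A`-frame. Proof: module docstring.
[cite: Deligne1982HodgeCycles, §4 Cor. 4.2, Lemma 4.6 and Sublemma 4.7]
[cite: vanGeemen1994HodgeAV, Lemma 5.2 (2)–(3) and 5.4 (5.4.1)] -/
theorem isHyperbolicWeilType_of_isotropic_cmSubspace (hW : IsWeilTypeCM A η R e₀ k)
    {h : complexBetti A.X 2} (hQ : IsRationalClass h)
    (hros : ∀ x y : complexBetti A.X 1,
      polarizationPairingOne A.X h (A.dim - 1) (pullbackOne A η x) y =
        -polarizationPairingOne A.X h (A.dim - 1) x (pullbackOne A η y))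
    {x : Fin (2 * k) → complexBetti A.X 1} {ω : complexBetti A.X (2 + 2 * (A.dim - 1))}
    {c : Fin (2 * k) → Fin (2 * k) → Fin (2 * e₀) → ℚ}
    {Φ : Matrix (Fin (2 * k)) (Fin (2 * k)) (cmField R)}
    (hx : ∀ b, IsRationalClass (x b))
    (hind : LinearIndependent ℂ
      (fun p : Fin (2 * e₀) × Fin (2 * k) => (pullbackOne A η ^ (p.1 : ℕ)) (x p.2)))
    (hω : IsRationalClass ω) (hω0 : ω ≠ 0)
    (hQx : ∀ (a b : Fin (2 * k)) (j : Fin (2 * e₀)),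
      polarizationPairingOne A.X h (A.dim - 1) ((pullbackOne A η ^ (j : ℕ)) (x a)) (x b) =
        ((c a b j : ℚ) : ℂ) • ω)
    (htr : ∀ (a b : Fin (2 * k)) (j : Fin (2 * e₀)),
      Algebra.trace ℚ (cmField R) (cmRoot R ^ (j : ℕ) * Φ a b) = c a b j)
    (W : Submodule (cmField R) (Fin (2 * k) → cmField R))
    (hWk : Module.finrank (cmField R) W = k)
    (hiso : ∀ v ∈ W, ∀ w ∈ W, ∑ a, ∑ b, v a * Φ a b * cmConj R (w b) = 0) :
    IsHyperbolicWeilType A η (k * e₀) h := by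
  classical
  haveI : Fact (Irreducible (cmPolyQ R)) := hW.fact_irreducible_cmPolyQ
  -- ### numerology: `dim A = m + 1`, the top line, `deg P_R = 2e₀`
  have hk := hW.k_pos
  have he := hW.e₀_pos
  have h2 := hW.two_le_dim
  have hA : A.dim = (A.dim - 1) + 1 := by omega
  have hX : IsSmoothProjective (A.dim - 1 + 1) A.X := Motives.isSmoothProjective_of_dim_eq' hA
  have h1 := Motives.finrank_complexBetti_two_add_two_mul_eq_one hX
  have hdeg : (cmPolyQ R).natDegree = 2 * e₀ := hW.natDegree_cmPolyQ
  have hP0 : cmPolyQ R ≠ 0 := fun h0 ↦ by rw [h0, Polynomial.natDegree_zero] at hdeg; omega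
  -- ### the rational form `ψ = Q_h / ω` on `V = H¹(A, ℚ)`
  set V := ↥(bettiCohomology A.X 1) with hVdef
  let ψ : V →ₗ[ℚ] V →ₗ[ℚ] ℚ :=
    ratPolarizationForm h hQ (A.dim - 1) (lineCoord ω hω0 h1) (lineCoord_ratValued _ hω hω0)
  have hψspec : ∀ v w : V, polarizationPairingOne A.X h (A.dim - 1) (ofRatClass (ComplexPoints A.X) 1 v)
      (ofRatClass (ComplexPoints A.X) 1 w) = ((ψ v w : ℚ) : ℂ) • ω := fun v w ↦ by
    have hs : ((ψ v w : ℚ) : ℂ) = lineCoord ω hω0 h1 (polarizationPairingOne A.X h (A.dim - 1)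
        (ofRatClass (ComplexPoints A.X) 1 v) (ofRatClass (ComplexPoints A.X) 1 w)) :=
      ratPolarizationForm_spec h hQ (A.dim - 1) (lineCoord ω hω0 h1) (lineCoord_ratValued _ hω hω0) v w
    rw [hs, lineCoord_smul_self]
  -- ### `H¹(A, ℚ)` as an `E`-vector space, `t` acting as `η^*_ℚ`
  set J : Module.End ℚ V := (bettiCohomology.map η.hom.hom.hom 1).hom with hJdef
  obtain ⟨instM, hinst⟩ := exists_module_cmField_smul_eq hW
  letI : Module (cmField R) V := instM
  obtain ⟨instT, htJ⟩ := hinst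
  haveI : IsScalarTower ℚ (cmField R) V := instT
  haveI : Module.Finite ℚ V := finite_bettiCohomology_one A
  haveI : Module.Finite (cmField R) V := Module.Finite.of_restrictScalars_finite ℚ (cmField R) V
  -- Rosati: `ψ(J v, w) = -ψ(v, J w)`, hence `ψ(e v, w) = ψ(v, ē w)`
  have hJψ : ∀ v w : V, ψ (J v) w = -ψ v (J w) := fun v w ↦ by
    apply Rat.cast_injective (α := ℂ)
    have e1 := ratPolarizationForm_spec h hQ (A.dim - 1) (lineCoord ω hω0 h1) (lineCoord_ratValued _ hω hω0) (J v) w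
    have e2 := ratPolarizationForm_spec h hQ (A.dim - 1) (lineCoord ω hω0 h1) (lineCoord_ratValued _ hω hω0) v (J w)
    rw [Rat.cast_neg]
    change ((ψ (J v) w : ℚ) : ℂ) = _ at e1
    change ((ψ v (J w) : ℚ) : ℂ) = _ at e2
    rw [e1, e2, hJdef, ofRatClass_bettiMap, ofRatClass_bettiMap, ← map_neg]
    exact congrArg _ (hros _ _)
  have hψσ : ∀ (e : cmField R) (v w : V), ψ (e • v) w = ψ v (cmConj R e • w) :=
    smul_cmConj_of_cmRoot ψ fun v w ↦ by rw [htJ, htJ, hJψ]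
  -- ### the vectors `β_b` with `x_b = β_b ⊗ 1`
  have hxr : ∀ b, ∃ v : V, ofRatClass (ComplexPoints A.X) 1 v = x b := fun b ↦
    (isRationalClass_iff_mem_range_ofRatClass _).1 (hx b)
  choose β hβ using hxr
  -- `tʲ • v = (η^*_ℚ)ʲ v`, `(η^*)ʲ (v ⊗ 1) = (tʲ • v) ⊗ 1`
  have htpow : ∀ (j : ℕ) (v : V), cmRoot R ^ j • v = (J ^ j) v := by
    intro j v
    induction j with
    | zero => rw [pow_zero, pow_zero, one_smul, Module.End.one_apply]
    | succ j ih => rw [pow_succ', mul_smul, ih, htJ, pow_succ', Module.End.mul_apply]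
  have hpull : ∀ (j : ℕ) (v : V), (pullbackOne A η ^ j) (ofRatClass (ComplexPoints A.X) 1 v) =
      ofRatClass (ComplexPoints A.X) 1 (cmRoot R ^ j • v) := fun j v ↦ by
    rw [pullbackOne_pow_ofRatClass, htpow]
  -- ### the `ℚ`-family `tʲ β_b` is independent and spans; `β` is an `E`-basis
  have hindQ : LinearIndependent ℚ (fun p : Fin (2 * e₀) × Fin (2 * k) ↦ cmRoot R ^ (p.1 : ℕ) • β p.2) := by
    rw [← linearIndependent_ringChange_iff]
    have hfun : (fun p : Fin (2 * e₀) × Fin (2 * k) ↦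
        singularCohomology.ringChange (algebraMap ℚ ℂ) (ComplexPoints A.X) 1 (cmRoot R ^ (p.1 : ℕ) • β p.2)) =
        fun p ↦ (pullbackOne A η ^ (p.1 : ℕ)) (x p.2) := by
      funext p
      rw [← ofRatClass_eq_ringChange, ← hpull, hβ]
    rw [hfun]
    exact hind
  let pb : PowerBasis ℚ (cmField R) := AdjoinRoot.powerBasis hP0
  have hpbdim : pb.dim = 2 * e₀ := by rw [AdjoinRoot.powerBasis_dim, hdeg]
  have hEQ : Module.finrank ℚ (cmField R) = 2 * e₀ := by rw [pb.finrank, hpbdim]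
  have hVQ : Module.finrank ℚ V = 2 * A.dim := finrank_bettiCohomology_one A
  have hVK : Module.finrank (cmField R) V = 2 * k := by
    have e1 : Module.finrank ℚ (cmField R) * Module.finrank (cmField R) V = Module.finrank ℚ V :=
      Module.finrank_mul_finrank ℚ (cmField R) V
    rw [hEQ, hVQ, hW.dim_eq] at e1
    have e2 : 2 * e₀ * Module.finrank (cmField R) V = 2 * e₀ * (2 * k) := by rw [e1]; ring
    exact Nat.eq_of_mul_eq_mul_left (by omega) e2
  haveI : Nonempty (Fin (2 * e₀) × Fin (2 * k)) := ⟨(⟨0, by omega⟩, ⟨0, by omega⟩)⟩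
  have hspanQ : Submodule.span ℚ (Set.range fun p : Fin (2 * e₀) × Fin (2 * k) ↦ cmRoot R ^ (p.1 : ℕ) • β p.2) = ⊤ :=
    hindQ.span_eq_top_of_card_eq_finrank (by
      rw [Fintype.card_prod, Fintype.card_fin, Fintype.card_fin, hVQ, hW.dim_eq]; ring)
  have hspanE : ⊤ ≤ Submodule.span (cmField R) (Set.range β) := by
    have hle : Submodule.span ℚ (Set.range fun p : Fin (2 * e₀) × Fin (2 * k) ↦ cmRoot R ^ (p.1 : ℕ) • β p.2) ≤
        (Submodule.span (cmField R) (Set.range β)).restrictScalars ℚ := by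
      rw [Submodule.span_le]
      rintro _ ⟨p, rfl⟩
      change cmRoot R ^ (p.1 : ℕ) • β p.2 ∈ Submodule.span (cmField R) (Set.range β)
      exact Submodule.smul_mem _ _ (Submodule.subset_span (Set.mem_range_self p.2))
    intro v _
    have hv : v ∈ Submodule.span ℚ (Set.range fun p : Fin (2 * e₀) × Fin (2 * k) ↦ cmRoot R ^ (p.1 : ℕ) • β p.2) := by
      rw [hspanQ]; exact Submodule.mem_top
    exact hle hv
  have hβind : LinearIndependent (cmField R) β :=
    linearIndependent_of_top_le_span_of_card_eq_finrank hspanE (by rw [Fintype.card_fin, hVK])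
  -- ### `Φ_{ab} = φ₁(β_a, β_b)` (trace duality, Sublemma 4.7)
  have hψc : ∀ (a b : Fin (2 * k)) (j : Fin (2 * e₀)), ψ (cmRoot R ^ (j : ℕ) • β a) (β b) = c a b j := by
    intro a b j
    have e1 := hQx a b j
    rw [← hβ a, ← hβ b, hpull, hψspec] at e1
    exact_mod_cast smul_left_injective ℂ hω0 e1
  have hΦ : ∀ a b, hermitianCoeff (cmField R) ψ (β a) (β b) = Φ a b := by
    intro a b
    apply hermitianCoeff_eq_of_trace
    intro e
    -- both sides are `ℚ`-linear in `e` and agree on the power basis `tʲ`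
    let f : cmField R →ₗ[ℚ] ℚ := (Algebra.trace ℚ (cmField R)) ∘ₗ LinearMap.mulLeft ℚ (Φ a b)
    let g : cmField R →ₗ[ℚ] ℚ := smulFunctional (cmField R) ψ (β a) (β b)
    have hfg : f = g := by
      refine pb.basis.ext fun j ↦ ?_
      have hj : pb.basis j = cmRoot R ^ ((finCongr hpbdim j : Fin (2 * e₀)) : ℕ) := by
        rw [pb.basis_eq_pow, AdjoinRoot.powerBasis_gen]
        rfl
      change Algebra.trace ℚ (cmField R) (Φ a b * pb.basis j) = ψ (pb.basis j • β a) (β b)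
      rw [hj, mul_comm]
      exact (htr a b (finCongr hpbdim j)).trans (hψc a b (finCongr hpbdim j)).symm
    exact LinearMap.congr_fun hfg e
  -- ### the `E`-linear embedding `L(α) = Σ α_a β_a` and the subspace `W' = L(W)`
  let L : (Fin (2 * k) → cmField R) →ₗ[cmField R] V := Fintype.linearCombination (cmField R) β
  have hLapply : ∀ α : Fin (2 * k) → cmField R, L α = ∑ a, α a • β a := fun α ↦
    Fintype.linearCombination_apply (cmField R) β α
  have hLinj : Function.Injective L := hβind.fintypeLinearCombination_injective
  let W' : Submodule (cmField R) V := W.map L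
  have hW'E : Module.finrank (cmField R) W' = k := by
    rw [← hWk]
    exact (LinearEquiv.finrank_eq (Submodule.equivMapOfInjective L hLinj W)).symm
  haveI : Module.Finite ℚ W' := Module.Finite.trans (cmField R) W'
  have hW'Q : Module.finrank ℚ W' = 2 * (k * e₀) := by
    have e1 : Module.finrank ℚ (cmField R) * Module.finrank (cmField R) W' = Module.finrank ℚ W' :=
      Module.finrank_mul_finrank ℚ (cmField R) W'
    rw [hEQ, hW'E] at e1
    rw [← e1]; ring
  -- a `ℚ`-basis `γ` of `W'` and the frame `u = γ ⊗ 1`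
  let γ : Basis (Fin (2 * (k * e₀))) ℚ W' := Module.finBasisOfFinrankEq ℚ W' hW'Q
  set u : Fin (2 * (k * e₀)) → complexBetti A.X 1 := fun i ↦ ofRatClass (ComplexPoints A.X) 1 ((γ i : W') : V)
    with hudef
  -- (i) `ℂ`-independence from the `ℚ`-independence of `γ`
  have hγQ : LinearIndependent ℚ (fun i ↦ ((γ i : W') : V)) :=
    γ.linearIndependent.map' (W'.subtype.restrictScalars ℚ) (by
      rw [LinearMap.ker_restrictScalars, Submodule.ker_subtype, Submodule.restrictScalars_bot])
  have hindC : LinearIndependent ℂ u := by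
    have hfun : (fun i ↦ singularCohomology.ringChange (algebraMap ℚ ℂ) (ComplexPoints A.X) 1 ((γ i : W') : V)) = u := by
      funext i
      exact (ofRatClass_eq_ringChange 1 _).symm
    rw [← hfun]
    exact (linearIndependent_ringChange_iff _).2 hγQ
  -- (ii) `η^*`-stability: `η^*(γᵢ ⊗ 1) = (t • γᵢ) ⊗ 1` and `t • γᵢ ∈ W' = ⟨γ⟩_ℚ`
  have hstab : ∀ i, complexBetti.map η.hom.hom.hom 1 (u i) ∈ Submodule.span ℂ (Set.range u) := by
    intro i
    have hdecomp : cmRoot R • ((γ i : W') : V) = ∑ l, (γ.repr (cmRoot R • γ i) l : ℚ) • ((γ l : W') : V) := by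
      have e1 := congrArg (fun w : W' ↦ (w : V)) (γ.sum_repr (cmRoot R • γ i))
      simp only [Submodule.coe_sum, Submodule.coe_smul_of_tower] at e1
      rw [← e1]
    rw [hudef]
    change complexBetti.map η.hom.hom.hom 1 (ofRatClass (ComplexPoints A.X) 1 ((γ i : W') : V)) ∈ _
    rw [← ofRatClass_bettiMap]
    change ofRatClass (ComplexPoints A.X) 1 (J ((γ i : W') : V)) ∈ _
    rw [← htJ, hdecomp, map_sum]
    refine Submodule.sum_mem _ fun l _ ↦ ?_
    rw [Motives.ofRatClass_smul]
    exact Submodule.smul_mem _ _ (Submodule.subset_span ⟨l, rfl⟩)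
  -- (iii) isotropy: `Q_h(γᵢ ⊗ 1, γⱼ ⊗ 1) = ψ(γᵢ, γⱼ) ω = Tr(0) ω`
  have hiso' : ∀ i j, polarizationPairingOne A.X h (A.dim - 1) (u i) (u j) = 0 := by
    intro i j
    obtain ⟨α, hαW, hα⟩ := Submodule.mem_map.1 (γ i).2
    obtain ⟨α', hα'W, hα'⟩ := Submodule.mem_map.1 (γ j).2
    rw [hudef]
    change polarizationPairingOne A.X h (A.dim - 1) (ofRatClass (ComplexPoints A.X) 1 ((γ i : W') : V))
      (ofRatClass (ComplexPoints A.X) 1 ((γ j : W') : V)) = 0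
    rw [hψspec, ← hα, ← hα', hLapply, hLapply,
      form_sum_smul_eq_zero_of_isotropic ψ (cmConj R) (cmConj_cmConj R) hψσ β ?_, Rat.cast_zero, zero_smul]
    simp_rw [hΦ]
    exact hiso α hαW α' hα'W
  -- ### packaging (`2 · (k e₀) - 1 = dim A - 1`)
  have hidx : 2 * (k * e₀) - 1 = A.dim - 1 := by rw [hW.dim_eq, mul_assoc]
  refine ⟨u, fun i ↦ ?_, hindC, hstab, fun i j ↦ ?_⟩
  · rw [hudef]
    exact isRationalClass_ofRatClass _
  · have key : ∀ m : ℕ, m = A.dim - 1 → polarizationPairingOne A.X h m (u i) (u j) = 0 := by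
      intro m hm
      subst hm
      exact hiso' i j
    exact key _ hidx

end Carriers

end Literature.AlgebraicGeometry.Deligne1982

end
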